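import Literature.Topology.FourManifolds.Handles
import Literature.Topology.FourManifolds.MorseHomologyVanishing
import Literature.Topology.FourManifolds.MorseTurnAbout
import Literature.Topology.FourManifolds.ImmersionOrientation
import Literature.Topology.FourManifolds.SPC4HandleChainProofs
import Literature.Topology.FourManifolds.SmaleHomologySpheresPropAHCobordism
import Literature.AlgebraicTopology.SingularHomology.SimplyConnectedH1
import Literature.AlgebraicTopology.SingularHomology.IntegralBockstein
import Literature.AlgebraicTopology.SingularHomology.CellsAttachmentEuler
import Mathlib.LinearAlgebra.Dimension.Torsion.Finite
import HarnessLib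

/-!
# A simply connected compact 2-handlebody with `χ = 1` is contractible

Topic `Literature/Topology/FourManifolds`; a proof file (no definitions, no named facts).  The
classical remark behind Kirby calculus on contractible 4-manifolds (corks, Mazur manifolds,
Stein / Lefschetz bisection pieces): a compact 4-manifold `W` built from one `0`-handle, `m`
`1`-handles and `m` `2`-handles is contractible as soon as it is simply connected.  Printed
argument: `W` has the homotopy type of a CW complex with one cell per handle (Milnor, *Morse
theory* (1963), Thm. 3.5), whose cellular chain complex `0 → ℤᵐ → ℤᵐ → ℤ → 0` has `H₀ = ℤ`,
`H₁ = 0` (`π₁ = 1`), hence an onto — so injective — boundary map `ℤᵐ → ℤᵐ`, `H₂ = 0`, and no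
homology above; a simply connected acyclic CW complex is contractible (Hurewicz, Hatcher
*Algebraic Topology* (2002) Thm. 4.32 / Cor. 4.33, and Whitehead, Thm. 4.5).

The proof given here runs in the tree's Morse vocabulary
(`Literature.Topology.FourManifolds.IsMorseAdapted`,
`Literature.Topology.FourManifolds.HasHandleDecomposition`) and in every dimension `n + 1 ≥ 3`:

* `Hⱼ(W; M) = 0` for `j ≥ 3` and all coefficients, since no critical point has index `≥ 3`
  (Milnor 1963, Thm. 3.5 with §5 — the tree's
  `IsMorseAdapted.isZero_singularHomology_of_forall_morseIndex_ne`);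
* `H₁(W; ℤ) = 0` by simple connectivity (`isZero_singularHomology_one_of_simplyConnectedSpace`);
* the Morse equality `χ(W) = Σₖ (-1)ᵏ cₖ = c₀ - c₁ + c₂ = 1` (Matsumoto Cor. 4.19, the tree's
  `IsMorseAdapted.finRelHomology_empty`) then gives `rank_ℤ H₂(W; ℤ) = 0`, and `H₂(W; ℤ)` has no
  torsion by the Bockstein sequence, `H₃(W; ℤ/d) = 0 ⇒ (d·)` injective on `H₂(W; ℤ)` (Hatcher
  §3.E, the tree's `singularHomology.zsmul_right_injective_of_isZero`); a finitely generated
  abelian group of rank `0` without torsion is trivial, so `H̃_*(W; ℤ) = 0`;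
* the maximum of the Morse function is not an interior point (it would be a critical point of
  index `n + 1 ≥ 3`), so `∂W ≠ ∅`, and a compact simply connected acyclic manifold with nonempty
  boundary is contractible (Whitehead–Hurewicz for manifolds, Bredon VII Cor. 10.11, PROVED in the
  tree: `SmaleHomologySpheres.contractibleSpace_of_isZero_singularHomology`, through
  `Manifold.contractibleSpace_of_simplyConnected_of_acyclic_holds`).

Main results:

* `contractibleSpace_of_isMorseAdapted_of_morseIndex_le_two` — compact simply connected
  `(n+1)`-manifold with boundary, `n ≥ 2`, with a Morse function adapted to `∂W` all of whose
  critical points have index `≤ 2` and `c₀ - c₁ + c₂ = 1`: contractible;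
* `contractibleSpace_of_simplyConnected_of_hasHandleDecomposition` — the 4-dimensional
  2-handlebody form: one `0`-handle, `m` `1`-handles, `m` `2`-handles, nothing else, `π₁ = 1`
  ⟹ contractible.

## References

* A. Hatcher, *Algebraic Topology*, CUP (2002), Thm. 4.5, Thm. 4.32, Cor. 4.33, §3.E p. 303,
  Thm. 2.44. [HatcherAT2002]
* J. Milnor, *Morse theory*, Ann. of Math. Studies 51 (1963), Thm. 3.5, §5. [Milnor1963]
* G. E. Bredon, *Topology and Geometry*, GTM 139 (1993), VII Cor. 10.11. [Bredon1993]
* Y. Matsumoto, *An introduction to Morse theory*, AMS (2002), Cor. 4.19. [Matsumoto2001]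
-/

open scoped Manifold ContDiff Topology
open Set Function CategoryTheory Limits
open Literature.AlgebraicTopology.SingularHomology

noncomputable section

namespace Literature.Topology.FourManifolds

/-! ### Algebra: rank `0` and no torsion -/

/-- A finitely generated abelian group of rank `0` on which every positive integer acts
injectively is trivial (rank `0` means torsion, `Module.finrank_eq_zero_iff_isTorsion`).
[folklore] -/
private theorem subsingleton_of_finrank_int_eq_zero {A : Type*} [AddCommGroup A]
    [inst : Module ℤ A] [Module.Finite ℤ A] (h0 : Module.finrank ℤ A = 0)
    (htf : ∀ d : ℕ, 0 < d → Function.Injective fun x : A => (d : ℤ) • x) : Subsingleton A := by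
  have hT : Module.IsTorsion ℤ A := Module.finrank_eq_zero_iff_isTorsion.1 h0
  refine ⟨fun x y => ?_⟩
  rw [← sub_eq_zero]
  obtain ⟨a, ha⟩ := @hT (x - y)
  have ha0 : (a : ℤ) ≠ 0 := nonZeroDivisors.coe_ne_zero a
  -- `a • (x - y) = 0` in the `ℤ`-module structure `inst`; read it as an integer multiple
  have hza : (a : ℤ) • (x - y) = 0 := by
    have h := int_smul_eq_zsmul inst (a : ℤ) (x - y)
    rw [← h]
    exact ha
  obtain ⟨d, hd⟩ := Int.eq_nat_or_neg (a : ℤ)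
  have hpos : 0 < d := by rcases hd with h | h <;> omega
  have hn : (d : ℤ) • (x - y) = 0 := by
    rcases hd with h | h
    · rw [← h]; exact hza
    · rw [h, neg_zsmul, neg_eq_zero] at hza; exact hza
  refine htf d hpos ?_
  change (d : ℤ) • (x - y) = (d : ℤ) • (0 : A)
  rw [hn, zsmul_zero]

/-! ### The general statement: indices `≤ 2`, `c₀ - c₁ + c₂ = 1`, `π₁ = 1` -/

section General

variable {n : ℕ} {W : Type} [TopologicalSpace W] [T2Space W] [SecondCountableTopology W]
  [CompactSpace W] [ChartedSpace (EuclideanHalfSpace (n + 1)) W] [IsManifold (𝓡∂ (n + 1)) ∞ W]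

/-- **A simply connected compact handlebody with handles of index `≤ 2` and Euler
characteristic `1` is contractible.**  Let `W` be a compact `(n+1)`-manifold with boundary,
`n ≥ 2`, simply connected, carrying a Morse function `f` adapted to `∂W` all of whose critical
points have index `≤ 2`, with `c₀ - c₁ + c₂ = 1` (`cₖ` the number of critical points of index
`k`).  Then `W` is contractible: `Hⱼ(W) = 0` for `j ≥ 3` (Milnor 1963, Thm. 3.5 with §5),
`H₁(W) = 0` (`π₁ = 1`), `χ(W) = Σ (-1)ᵏ cₖ = 1` forces `rank H₂(W; ℤ) = 0` and the Bockstein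
sequence with `H₃(W; ℤ/d) = 0` makes `H₂(W; ℤ)` torsion free, so `H̃_*(W; ℤ) = 0`; the maximum of
`f` lies on `∂W ≠ ∅` (an interior maximum would have index `n + 1 ≥ 3`); and a simply
connected acyclic compact manifold with nonempty boundary is contractible (Hurewicz and
Whitehead, Hatcher Thm. 4.32 / Cor. 4.33 / Thm. 4.5, for the CW type of `W`, Milnor Thm. 3.5;
in the tree Bredon VII Cor. 10.11 for manifolds).
[cite: HatcherAT2002, Thm. 4.5 and Cor. 4.33 (with Thm. 4.32, §3.E p. 303)]
[cite: Milnor1963, Thm. 3.5 and §5] -/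
theorem contractibleSpace_of_isMorseAdapted_of_morseIndex_le_two (hn : 2 ≤ n)
    [SimplyConnectedSpace W] {f : W → ℝ} (hf : IsMorseAdapted (𝓡∂ (n + 1)) f)
    (h3 : ∀ z ∈ criticalSet (𝓡∂ (n + 1)) f, morseIndex (𝓡∂ (n + 1)) f z ≤ 2)
    (hχ : ∑ k ∈ Finset.range 3,
      (-1 : ℤ) ^ k * ((criticalSetOfIndex (𝓡∂ (n + 1)) f k).ncard : ℤ) = 1) :
    ContractibleSpace W := by
  -- no critical point has index `j ≥ 3`
  have hne : ∀ j, 3 ≤ j →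
      ∀ z ∈ criticalSet (𝓡∂ (n + 1)) f, morseIndex (𝓡∂ (n + 1)) f z ≠ j :=
    fun j hj z hz h => by have := h3 z hz; omega
  have hempty : ∀ k, 3 ≤ k → criticalSetOfIndex (𝓡∂ (n + 1)) f k = ∅ := fun k hk =>
    Set.eq_empty_of_forall_notMem fun z hz => hne k hk z hz.1 hz.2
  -- `H_j(W) = 0` for `j ≥ 3`, with coefficients `ℤ` and `ℤ/d`
  have hZint : ∀ j, 3 ≤ j → IsZero (singularHomology ℤ ℤ W j) := fun j hj =>
    hf.isZero_singularHomology_of_forall_morseIndex_ne ℤ ℤ (hne j hj)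
  have hZmod : ∀ (d : ℕ) (j : ℕ), 3 ≤ j → IsZero (singularHomology ℤ (ZMod d) W j) :=
    fun d j hj => hf.isZero_singularHomology_of_forall_morseIndex_ne ℤ (ZMod d) (hne j hj)
  -- `H₁(W) = 0`
  have hZ1 : IsZero (singularHomology ℤ ℤ W 1) :=
    isZero_singularHomology_one_of_simplyConnectedSpace ℤ ℤ
  -- the Morse equality `χ(W) = Σ (-1)^k c_k = c₀ - c₁ + c₂ = 1`
  obtain ⟨hFin, hχ'⟩ := hf.finRelHomology_empty ℤ ℤ
  have hcount : ∑ k ∈ Finset.range (n + 2),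
      (-1 : ℤ) ^ k * ((criticalSetOfIndex (𝓡∂ (n + 1)) f k).ncard : ℤ) = 1 := by
    have hs : ∑ k ∈ Finset.range 3,
        (-1 : ℤ) ^ k * ((criticalSetOfIndex (𝓡∂ (n + 1)) f k).ncard : ℤ) =
        ∑ k ∈ Finset.range (n + 2),
          (-1 : ℤ) ^ k * ((criticalSetOfIndex (𝓡∂ (n + 1)) f k).ncard : ℤ) :=
      Finset.sum_subset (Finset.range_mono (show 3 ≤ n + 2 by omega)) fun k _ hk3 => by
        rw [hempty k (by simpa using hk3), Set.ncard_empty, Nat.cast_zero, mul_zero]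
    rw [← hs]
    exact hχ
  have hrank : ∑ k ∈ Finset.range (n + 2),
      (-1 : ℤ) ^ k * (Module.finrank ℤ (singularHomology ℤ ℤ W k) : ℤ) = 1 := by
    rw [← hFin.relEuler_empty_eq_sum, hχ', hcount, Module.finrank_self ℤ]
    simp
  -- hence `rank H₂(W; ℤ) = 0`
  have hr2 : Module.finrank ℤ (singularHomology ℤ ℤ W 2) = 0 := by
    have hsplit : ∑ k ∈ Finset.range (n + 2),
        (-1 : ℤ) ^ k * (Module.finrank ℤ (singularHomology ℤ ℤ W k) : ℤ) =
        ∑ k ∈ Finset.range 3,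
          (-1 : ℤ) ^ k * (Module.finrank ℤ (singularHomology ℤ ℤ W k) : ℤ) := by
      symm
      refine Finset.sum_subset (Finset.range_mono (show 3 ≤ n + 2 by omega)) ?_
      intro k _ hk3
      rw [finrank_eq_zero_of_isZero (hZint k (by simpa using hk3)), Nat.cast_zero, mul_zero]
    rw [hsplit, Finset.sum_range_succ, Finset.sum_range_succ, Finset.sum_range_succ,
      Finset.sum_range_zero, finrank_singularHomology_zero_of_pathConnectedSpace ℤ ℤ,
      Module.finrank_self ℤ, finrank_eq_zero_of_isZero hZ1] at hrank
    norm_num at hrank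
    exact_mod_cast hrank
  -- `H₂(W; ℤ)` has no torsion (Bockstein with `H₃(W; ℤ/d) = 0`), hence vanishes
  have htf : ∀ d : ℕ, 0 < d →
      Function.Injective fun x : singularHomology ℤ ℤ W 2 => (d : ℤ) • x :=
    fun d hd => singularHomology.zsmul_right_injective_of_isZero hd 2 (hZmod d 3 le_rfl)
  haveI : Module.Finite ℤ (singularHomology ℤ ℤ W 2) := hFin.finite_singularHomology 2
  haveI : Subsingleton (singularHomology ℤ ℤ W 2) := subsingleton_of_finrank_int_eq_zero hr2 htf
  have hZ2 : IsZero (singularHomology ℤ ℤ W 2) := ModuleCat.isZero_of_subsingleton _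
  have hall : ∀ k : ℕ, 0 < k → IsZero (singularHomology ℤ ℤ W k) := by
    intro k hk
    rcases (show k = 1 ∨ k = 2 ∨ 3 ≤ k by omega) with rfl | rfl | hk3
    · exact hZ1
    · exact hZ2
    · exact hZint k hk3
  -- the boundary is nonempty: the maximum of `f` is not an interior point
  obtain ⟨p, -, hp⟩ := isCompact_univ.exists_isMaxOn univ_nonempty
    hf.isMorse.contMDiff.continuous.continuousOn
  have hpb : p ∈ (𝓡∂ (n + 1)).boundary W := by
    rcases (𝓡∂ (n + 1)).isInteriorPoint_or_isBoundaryPoint p with hint | hbd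
    · exfalso
      have hloc : IsLocalMax f p := hp.isLocalMax Filter.univ_mem
      have hcrit : IsMCriticalPt (𝓡∂ (n + 1)) f p := isMCriticalPt_of_isLocalMax hloc hint
      have hmin : IsLocalMin (fun y => 0 - f y) p := by
        have h' := hloc.neg
        simp only [zero_sub]
        exact h'
      have h0 : morseIndex (𝓡∂ (n + 1)) (fun y => 0 - f y) p = 0 :=
        morseIndex_eq_zero_of_isLocalMin_of_isInteriorPoint
          ((hf.isMorse.const_sub 0).contMDiff.contMDiffAt.of_le (by norm_cast)) hmin hint
      have hadd := hf.isMorse.morseIndex_const_sub_add 0 hcrit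
      rw [h0, finrank_euclideanSpace_fin, zero_add] at hadd
      have := h3 p hcrit
      omega
    · exact hbd
  haveI : Nonempty ((𝓡∂ (n + 1)).boundary W) := ⟨⟨p, hpb⟩⟩
  -- Whitehead–Hurewicz for compact manifolds with nonempty boundary
  obtain ⟨m, rfl⟩ : ∃ m, n = m + 1 := ⟨n - 1, by omega⟩
  exact SmaleHomologySpheres.contractibleSpace_of_isZero_singularHomology (m := m) (W := W)
    hall

end General

/-! ### The 4-dimensional 2-handlebody -/

/-- **A simply connected compact 4-dimensional 2-handlebody with `χ = 1` is contractible.**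
If a compact smooth 4-manifold with boundary `W` has a handle decomposition with one `0`-handle,
`m` `1`-handles, `m` `2`-handles and no other handles (in the tree's Morse form
`Literature.Topology.FourManifolds.HasHandleDecomposition`: a Morse function adapted to `∂W`
with these numbers of critical points of each index) and `π₁(W) = 1`, then `W` is contractible:
`W` has the homotopy type of a CW complex with one `k`-cell per `k`-handle (Milnor 1963,
Thm. 3.5), `H₁ = 0` makes the square boundary matrix `ℤᵐ → ℤᵐ` onto hence injective, so
`H̃_*(W) = 0`, and Hurewicz–Whitehead (Hatcher Thm. 4.32, Cor. 4.33, Thm. 4.5) conclude; here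
deduced from `contractibleSpace_of_isMorseAdapted_of_morseIndex_le_two`.
[cite: HatcherAT2002, Thm. 4.5 and Cor. 4.33] [cite: Milnor1963, Thm. 3.5] -/
theorem contractibleSpace_of_simplyConnected_of_hasHandleDecomposition (W : Type)
    [TopologicalSpace W] [T2Space W] [SecondCountableTopology W]
    [ChartedSpace (EuclideanHalfSpace 4) W] [IsManifold (𝓡∂ 4) ∞ W] [CompactSpace W]
    [SimplyConnectedSpace W] (m : ℕ)
    (h : HasHandleDecomposition 3 W (fun k => if k = 0 then 1 else if k ≤ 2 then m else 0)) :
    ContractibleSpace W := by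
  obtain ⟨f, hf, hc⟩ := h
  have hfin : (criticalSet (𝓡∂ (3 + 1)) f).Finite :=
    IsMorse.finite_criticalSet_holds hf.isMorse
  refine contractibleSpace_of_isMorseAdapted_of_morseIndex_le_two (n := 3) (by norm_num) hf
    ?_ ?_
  · -- no critical point of index `≥ 3`: those critical sets have `ncard = 0` and are finite
    intro z hz
    by_contra hlt
    have hmem : z ∈ criticalSetOfIndex (𝓡∂ (3 + 1)) f (morseIndex (𝓡∂ (3 + 1)) f z) :=
      ⟨hz, rfl⟩
    have h0 :
        (criticalSetOfIndex (𝓡∂ (3 + 1)) f (morseIndex (𝓡∂ (3 + 1)) f z)).ncard = 0 := by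
      have h := hc (morseIndex (𝓡∂ (3 + 1)) f z)
      simp only [if_neg (show ¬ morseIndex (𝓡∂ (3 + 1)) f z = 0 by omega),
        if_neg (show ¬ morseIndex (𝓡∂ (3 + 1)) f z ≤ 2 by omega)] at h
      exact h
    rw [Set.ncard_eq_zero (hfin.subset (criticalSetOfIndex_subset _ f _))] at h0
    rw [h0] at hmem
    exact hmem
  · -- `c₀ - c₁ + c₂ = 1 - m + m = 1`
    simp only [hc]
    norm_num [Finset.sum_range_succ]

end Literature.Topology.FourManifolds

end
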